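import Mathlib
import Literature.Analysis.FluidPDE.Tao2016AveragedNS.ShiftSetCascadeFlows
import Literature.Analysis.FluidPDE.Tao2016AveragedNS.ShiftSetCascadeFlux
import Summits.NavierStokesRegularity.NavierStokesRegularity.Theorems.TaoLadderRungTwoFlatCertificateGlueCheckerStepOn
import Summits.NavierStokesRegularity.NavierStokesRegularity.Theorems.TaoLadderRungTwoFlatCertificateGlueCheckerTableOn
import Summits.NavierStokesRegularity.NavierStokesRegularity.Theorems.TaoLadderRungTwoFlatCertificateGlueCheckerCoefOn
import Summits.NavierStokesRegularity.NavierStokesRegularity.Theorems.TaoLadderRungTwoFlatCertificateGlueCheckerGronwallOn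
import Summits.NavierStokesRegularity.NavierStokesRegularity.Theorems.TaoLadderRungTwoFlatCertificateGlueCheckerDefectOn
import HarnessLib

/-!
# Certificate glue on a shift set `𝕊`, XXVII: THE STEP CHECKER, ASSEMBLED — `StepCert j` of the window system from the Boolean
  tests of ONE Lohner step over rational / dyadic data (helper for items stmt-NavierStokesRegularity-22987 `FlatGapCertificatesV2`
  (crux K_A♭ of route TaoLadderRungTwoFlat) and stmt-24295 K_A₂(64); cell harvest/h2-tao-ladder, p1 g15; CHECKER-SPEC-v3 §3 (iii))

`stepCert_of_checks` = glue XIX-e `stepCert_of_plohner_dense` with every analytic hypothesis discharged by a test of glues XXIV–XXVI: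
`checkB` ((B)-table, XXV-e) · `checkAbsLe` (C2) · `checkRowSum` (C3) · `checkTPoly`/`checkNVh`/`checkFrame`/`checkKappa`/`checkERec`
(C4–C8 via `landingClauses_of_checks`, XXVI) · `checkGuard`/`checkRegion` (C9) · `checkDefect` (C10, δ) · `checkGronwall` (C11, A) ·
`sqrtCheck` ×2 (coefficient boxes, XXIV-c). What stays as hypotheses: the data signs (`0 ≤ b, mC, ρC, δ, E₀`, `A < A'`, rationals —
decidable), `shifts` nearest-neighbour without duplicates, positive weights `ωq`, the step length `t (j+1) − t j = h`, and the three
NODE/HULL INCLUSIONS (`hN`, `hH`, `hN'`) which the chain builder makes definitional (`Node j := PInPara …`, next node := landing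
parallelepiped ⊕ A, `Hull j :=` time-resolved tube ⊕ A). `pointBoxA` presents the dyadic centre as the level-0 jet box.

HONEST FRAMING: Tao-type MODEL lattices (Tao 2016 §4/§6 vocabulary, shift-set parametrised); soundness of a checker — NO certificate
instance exists in the tree, nothing is certified here, no stub is closed, nothing here is a statement about the Navier–Stokes equations.
-/

-- the sub-problem namespace repeats the summit name by design (D-0017)
set_option linter.dupNamespace false

namespace Summit.NavierStokesRegularity.NavierStokesRegularity.Theorems

open Set Finset Literature.Analysis.FluidPDE Literature.Analysis.FluidPDE.TaoCascade
open Summit.NavierStokesRegularity.NavierStokesRegularity.Theorems.TaylorModelCert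
open Summit.NavierStokesRegularity.NavierStokesRegularity.Theorems.TaylorModelReadout

namespace CertificateGlueOn

/-- Point boxes of a dyadic vector (the level-0 jet box of the centre). [folklore] -/
def pointBoxA (n : ℕ) (v : Array Dyad) : Array IntervalD := Array.ofFn fun c : Fin n => IntervalD.ofDyad (dgetD v c)

/-- The denoted real vector lies in its point boxes. [folklore] -/
theorem mem_pointBoxA (n : ℕ) (v : Array Dyad) :
    ∀ c < n, IntervalD.mem (rdN (dvec (n := n) v) c) (IntervalD.aget (pointBoxA n v) c) := by
  intro c hc
  unfold pointBoxA
  rw [IntervalD.aget_ofFn _ hc, rdN_of_lt _ hc]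
  exact IntervalD.mem_ofDyad _

variable {m : ℕ} {Kb Ka : ℤ}

/-- **`StepCert` OF THE WINDOW SYSTEM FROM THE BOOLEAN TESTS OF ONE LOHNER STEP** (see the module docstring for the list of
tests and what remains hypothetical). [cite: Zgliczynski2002C1Lohner, §3–4 (Lohner-type parallelepiped frames and the C¹/variational enclosure); cell certificate format, step checker] -/
theorem stepCert_of_checks (hKb : 0 ≤ Kb) (hKa : 1 ≤ Ka) {shifts : List (ℤ × ℤ × ℤ)} (hnd : shifts.Nodup)
    (h𝕊 : IsNearestNeighbourSet shifts.toFinset) {q : ℚ} (hq : 0 < 1 + (q : ℝ))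
    {αq : Fin m → Fin m → Fin m → ℤ × ℤ × ℤ → ℚ} {ωq : Fin m → ℤ → ℚ} (hω : ∀ i k, 0 < ωq i k)
    {prec p kexp nexp : ℕ} {Sp Sm : IntervalD} (hSp : sqrtCheck prec (1 + q) Sp = true)
    (hSm : sqrtCheck prec (1 / (1 + q)) Sm = true)
    {M : ℤ → ℝ} {t : ℕ → ℝ} {Node Hull : ℕ → (Fin m → ℤ → ℝ) → Prop} {j : ℕ}
    {xD x'D rD r'D : Array Dyad} {C Cn Cin : Array (Array Dyad)} {bD mC ρC dP NVh κI δD : Dyad}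
    {R A A' Eb Et E₀ E₁ h : ℚ}
    -- data signs and the step length
    (hb : 0 ≤ bD.toReal) (hmC : 0 ≤ mC.toReal) (hρC : 0 ≤ ρC.toReal) (hE₀ : (0 : ℚ) ≤ E₀) (hδ : 0 ≤ δD.toReal)
    (hAA' : A < A') (hR0 : (0 : ℚ) ≤ R) (ht : t (j + 1) - t j = (h : ℝ))
    -- the tests
    (hchkB : checkB m Kb Ka shifts (coefBoxOf prec αq ωq Sp Sm) bD = true)
    (h2 : checkAbsLe (m * winLen Kb Ka) xD mC = true)
    (h3 : checkRowSum (m * winLen Kb Ka) C rD ρC = true)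
    (h4 : checkTPoly (m * winLen Kb Ka) prec
      (IntervalD.polyLevelsA (m * winLen Kb Ka) prec
        (IntervalD.jetLevelsA (m * winLen Kb Ka) (pqBoxA Kb Ka prec shifts (coefBoxOf prec αq ωq Sp Sm)) prec
          (pointBoxA (m * winLen Kb Ka) xD) p) p (ofRatRel prec h)) x'D dP = true)
    (h5 : checkNVh (m * winLen Kb Ka)
      (IntervalD.polyLevelsA (m * winLen Kb Ka) prec
        (IntervalD.varJetLevelsA (m * winLen Kb Ka) (pqBoxA Kb Ka prec shifts (coefBoxOf prec αq ωq Sp Sm)) prec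
          (IntervalD.jetLevelsA (m * winLen Kb Ka) (pqBoxA Kb Ka prec shifts (coefBoxOf prec αq ωq Sp Sm)) prec
            (pointBoxA (m * winLen Kb Ka) xD) p)
          (unitBoxA (m * winLen Kb Ka)) p) p (ofRatRel prec h)) NVh = true)
    (h6 : checkFrame (m * winLen Kb Ka)
      (pcolsA prec (m * winLen Kb Ka) Cin (vcolsA Kb Ka prec shifts (coefBoxOf prec αq ωq Sp Sm) p
        (IntervalD.jetLevelsA (m * winLen Kb Ka) (pqBoxA Kb Ka prec shifts (coefBoxOf prec αq ωq Sp Sm)) prec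
          (pointBoxA (m * winLen Kb Ka) xD) p) (ofRatRel prec h) C)) rD r'D = true)
    (h7 : checkKappa prec (m * winLen Kb Ka) Cn
      (pcolsA prec (m * winLen Kb Ka) Cin (vcolsA Kb Ka prec shifts (coefBoxOf prec αq ωq Sp Sm) p
        (IntervalD.jetLevelsA (m * winLen Kb Ka) (pqBoxA Kb Ka prec shifts (coefBoxOf prec αq ωq Sp Sm)) prec
          (pointBoxA (m * winLen Kb Ka) xD) p) (ofRatRel prec h) C))
      (vcolsA Kb Ka prec shifts (coefBoxOf prec αq ωq Sp Sm) p
        (IntervalD.jetLevelsA (m * winLen Kb Ka) (pqBoxA Kb Ka prec shifts (coefBoxOf prec αq ωq Sp Sm)) prec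
          (pointBoxA (m * winLen Kb Ka) xD) p) (ofRatRel prec h) C) rD κI = true)
    (h8 : checkERec p (dyadToRat bD) (dyadToRat mC) (dyadToRat ρC) E₀ (dyadToRat κI) (dyadToRat dP) (dyadToRat NVh) h E₁
      = true)
    (h9 : checkGuard (dyadToRat bD) (dyadToRat mC) (dyadToRat ρC) E₀ h = true)
    (h9' : checkRegion (dyadToRat bD) (dyadToRat mC) (dyadToRat ρC) E₀ h A' R = true)
    (h10 : checkDefect m Kb Ka prec shifts αq ωq R Eb Et Sp Sm δD = true)
    (h11 : checkGronwall (dyadToRat bD) R (dyadToRat δD) h A kexp nexp = true)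
    -- the node / hull inclusions (definitional for the chain builder)
    (hN : ∀ y, Node j y → PInPara Kb Ka (fun i k => (ωq i k : ℝ)) (dvec (n := m * winLen Kb Ka) xD)
      (dmat (n := m * winLen Kb Ka) C) (dvec (n := m * winLen Kb Ka) rD) (E₀ : ℝ) y)
    (hH : ∀ u ∈ Icc 0 (h : ℝ), ∀ y q' : Fin m → ℤ → ℝ,
      TubeL shifts.toFinset (q : ℝ) (fun i₁ i₂ i μ => (αq i₁ i₂ i μ : ℝ)) Kb Ka (fun i k => (ωq i k : ℝ)) p bD.toReal mC.toReal
        ρC.toReal (E₀ : ℝ) ((mC.toReal + (ρC.toReal + (E₀ : ℝ))) / (1 - bD.toReal * (mC.toReal + (ρC.toReal + (E₀ : ℝ))) * (h : ℝ)))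
        (dvec (n := m * winLen Kb Ka) xD) (dmat (n := m * winLen Kb Ka) C) (dvec (n := m * winLen Kb Ka) rD) u q' →
      (∀ i k, -Kb ≤ k → k ≤ Ka → |y i k - q' i k| ≤ (A : ℝ) * (ωq i k : ℝ)) → Hull j y)
    (hN' : ∀ y, PInPara Kb Ka (fun i k => (ωq i k : ℝ)) (dvec (n := m * winLen Kb Ka) x'D)
      (dmat (n := m * winLen Kb Ka) Cn) (dvec (n := m * winLen Kb Ka) r'D) ((E₁ : ℝ) + (A : ℝ)) y → Node (j + 1) y) :
    StepCert shifts.toFinset (q : ℝ) (fun i₁ i₂ i μ => (αq i₁ i₂ i μ : ℝ)) Kb Ka (Eb : ℝ) (Et : ℝ) M t Node Hull j := by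
  have hcoef := coefBoxOK_coefBoxOf (Kb := Kb) (Ka := Ka) prec hq αq ωq hSp hSm shifts
  have hω' : ∀ i k, (0 : ℝ) < (ωq i k : ℝ) := fun i k => by exact_mod_cast hω i k
  have hX : (pointBoxA (m * winLen Kb Ka) xD).size = m * winLen Kb Ka := by simp [pointBoxA]
  have hx := mem_pointBoxA (m * winLen Kb Ka) xD
  have hhmem : IntervalD.mem ((h : ℚ) : ℝ) (ofRatRel prec h) := mem_ofRatRel prec h
  -- scalar tests, casts bridged
  have hg := guard_of_check h9
  have hreg := region_of_check h9'
  have hgr := gronwall_of_check h11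
  simp only [cast_dyadToRat] at hg hreg hgr
  have hcl := landingClauses_of_checks (ω := fun i k => (ωq i k : ℝ)) (ε₀ := (q : ℝ))
    (α := fun i₁ i₂ i μ => (αq i₁ i₂ i μ : ℝ)) hKb hKa hnd hcoef p hX hx hhmem h4 h5 h6 h7 h8
  simp only [cast_dyadToRat] at hcl
  have hAA'r : (A : ℝ) < (A' : ℝ) := by exact_mod_cast hAA'
  refine stepCert_of_plohner_dense (ω := fun i k => (ωq i k : ℝ)) hKb hKa hq hω' hb hmC hρC (by exact_mod_cast hE₀) hδ
    hAA'r (by rw [ht]; exact hg.1) (by rw [ht]; exact hg.2) (hB_of_checkB hKb hKa hω' hq hnd hcoef hchkB)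
    (abs_le_of_checkAbsLe h2) (mulVec_le_of_checkRowSum h3) (by rw [ht]; exact hcl) (by rw [ht]; exact hreg)
    (pinputDefect_of_checkDefect prec hnd h𝕊 hq hω (by exact_mod_cast hR0) hSp hSm h10) (by rw [ht]; exact hgr) hN
    (fun u hu y q' hq' hnear => hH u (by rwa [ht] at hu) y q' (by rwa [ht] at hq') hnear) hN'

end CertificateGlueOn

end Summit.NavierStokesRegularity.NavierStokesRegularity.Theorems
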